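import Mathlib
import Summits.Ventures.PercRepro2.Defs
import Summits.Ventures.PercRepro2.Independence
import Summits.Ventures.PercRepro2.Harris
import Summits.Ventures.PercRepro2.Graph
import Summits.Ventures.PercRepro2.Events
import Summits.Ventures.PercRepro2.BHKEvents
import Summits.Ventures.PercRepro2.RProduct
import Summits.Ventures.PercRepro2.CaseOnePendant

/-!
# The weighted (PM) per-side bracket when a root is a leaf at the host (blind cell PercRepro2,
mine-2 g20; proofs/MINE2-CUTU.md Theorems 2–3, M2-42)

Roots `a₁, a₂`, marks `o, b`, host `u`; `a₂` a LEAF at `u` through the edge `e₀` (`IsLeafAt ends u a₂ e₀`),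
`β = p e₀`; `Q = {a₁ ↮ a₂}`, `L_v = {a₁ ↔ v}`, `H_v = {a₂ ↔ v}`, `oU = L_o ∪ H_o`.  The L-half of the
weighted (PM) identity (M2-35), multiplied out by `P(Q)³`:

  `HALF_L := P(Q)·[P(Q) P(L_b H_u oU Q) − P(L_b Q) P(H_u oU Q)] − P(oU Q)·[P(Q) P(L_b H_u Q) − P(L_b Q) P(H_u Q)]
            − P(Q)·[P(Q) P(L_b H_o Q) − P(L_b Q) P(H_o Q)]`

(`= P(Q)³ · (Cov_Q(L_b, H_u 1[o∈U]) − p_o Cov_Q(L_b, H_u) − Cov_Q(L_b, H_o))`).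

**Theorem `halfL_nonneg`: `0 ≤ HALF_L`.**  Mechanism: on the leaf class every event reduces, through the
state of `e₀` (independent of everything else), to events among `a₁, o, b, u` in `G − e₀`; with
`A = {a₁ ↔ u}` and the masses `t_u = P(A)`, `t_b = P(L_b)`, `k_bu = P(L_b A)`, `m_b = P(L_b Aᶜ)`, `t_o, k_ou, m_o`,
`m_bo = P(L_b L_o Aᶜ)`, `x_o = P({o ↔ u} Aᶜ)`, `y_bo = P(L_b {o↔u} Aᶜ)` the dictionary reads
`P(Q) = 1 − β t_u`, `P(L_b Q) = t_b − β k_bu`, `P(H_u Q) = β(1 − t_u)`, `P(L_b H_u Q) = β m_b`,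
`P(H_o Q) = β x_o`, `P(L_b H_o Q) = β y_bo`, `P(oU Q) = t_o − β k_ou + β x_o`, `P(H_u oU Q) = β(m_o + x_o)`,
`P(L_b H_u oU Q) = β(m_bo + y_bo)`, and then the exact polynomial identity

  `(1 − t_u) · HALF_L = β · [ P(Q)² · C_ū + (1 − β) · C_bu · ((1 − β) · C_ou + β (1 − t_u) x_o) ]`

with `C_ū = m_bo (1 − t_u) − m_b m_o ≥ 0` (BHK06 Thm 1.3: the cluster of `a₁` given `a₁ ↮ u` is positively
associated, `bhk_same_cluster_events`), `C_bu = k_bu − t_u t_b ≥ 0` and `C_ou = k_ou − t_u t_o ≥ 0` (Harris).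
When `t_u = 1` every mass on `Aᶜ` vanishes and `HALF_L = 0`.
-/

namespace Summit.Ventures.PercRepro2

namespace LeafRootPM

section Leaf

variable {V : Type*} {E : Type*} [Fintype E] [DecidableEq E] {ends : E → Sym2 V} {u a₂ : V} {e₀ : E}

omit [Fintype E] [DecidableEq E] in
/-- A vertex `x ≠ a₂` is connected to the leaf `a₂` iff `e₀` is open and `x ↔ u`. -/
lemma conn_to_leaf_iff (hl : CaseOne.IsLeafAt ends u a₂ e₀) (ω : Config E) {x : V} (hx : x ≠ a₂) :
    Conn ends ω x a₂ ↔ ω e₀ = true ∧ Conn ends ω x u := by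
  constructor
  · intro h
    have hopen : ω e₀ = true := by
      by_contra hne
      have hω : ω e₀ = false := by simpa using hne
      exact hx (CaseOne.eq_of_conn_leaf_of_closed hl hω (conn_symm h))
    refine ⟨hopen, conn_trans h ?_⟩
    exact conn_symm ((CaseOne.conn_leaf_iff hl ω).2 hopen)
  · rintro ⟨hopen, h⟩
    exact conn_trans h ((CaseOne.conn_leaf_iff hl ω).2 hopen)

omit [Fintype E] [DecidableEq E] in
/-- `{x ↔ a₂} = {e₀ open} ∩ {x ↔ u}` for `x ≠ a₂`. -/
lemma connEvent_leaf (hl : CaseOne.IsLeafAt ends u a₂ e₀) {x : V} (hx : x ≠ a₂) :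
    connEvent ends x a₂ = openEdge e₀ ∩ connEvent ends x u := by
  ext ω
  simp only [mem_connEvent, Set.mem_inter_iff, mem_openEdge]
  exact conn_to_leaf_iff hl ω hx

omit [Fintype E] [DecidableEq E] in
/-- `{a₂ ↔ x} = {e₀ open} ∩ {x ↔ u}` for `x ≠ a₂`. -/
lemma connEvent_leaf' (hl : CaseOne.IsLeafAt ends u a₂ e₀) {x : V} (hx : x ≠ a₂) :
    connEvent ends a₂ x = openEdge e₀ ∩ connEvent ends x u := by
  rw [← connEvent_leaf hl hx]
  ext ω
  simp only [mem_connEvent]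
  exact ⟨conn_symm, conn_symm⟩

omit [Fintype E] [DecidableEq E] in
/-- `{a₂ ↔ u} = {e₀ open}`. -/
lemma connEvent_leaf_u (hl : CaseOne.IsLeafAt ends u a₂ e₀) :
    connEvent ends a₂ u = openEdge e₀ := by
  ext ω
  simp only [mem_connEvent, mem_openEdge]
  exact ⟨fun h => (CaseOne.conn_leaf_iff hl ω).1 (conn_symm h),
    fun h => conn_symm ((CaseOne.conn_leaf_iff hl ω).2 h)⟩

omit [Fintype E] in
/-- A connection event between vertices `≠ a₂` is determined by the edges other than `e₀`. -/
lemma dependsOn_connEvent_of_leaf (hl : CaseOne.IsLeafAt ends u a₂ e₀) {x y : V} (hx : x ≠ a₂)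
    (hy : y ≠ a₂) : DependsOn (· ∈ connEvent ends x y) ({e₀}ᶜ : Set E) := by
  intro ω ω' h
  have hupd : Function.update ω e₀ false = Function.update ω' e₀ false := by
    funext e
    by_cases he : e = e₀
    · subst he; simp
    · rw [Function.update_of_ne he, Function.update_of_ne he]
      exact h e (by simpa using he)
  show (ω ∈ connEvent ends x y) = (ω' ∈ connEvent ends x y)
  apply propext
  simp only [mem_connEvent]
  rw [CaseOne.conn_iff_update_of_leaf hl ω hx hy, CaseOne.conn_iff_update_of_leaf hl ω' hx hy, hupd]

end Leaf

section Indep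

variable {E : Type*} [Fintype E] [DecidableEq E] {R : Type*} [CommRing R]

/-- An event determined by the edges other than `e₀` is independent of `{e₀ open}`. -/
lemma prob_inter_openEdge_of_dependsOn (p : E → R) {e₀ : E} {A : Set (Config E)}
    (hA : DependsOn (· ∈ A) ({e₀}ᶜ : Set E)) :
    prob p (A ∩ openEdge e₀) = prob p A * p e₀ := by
  rw [prob_inter_eq_mul_of_dependsOn p (F₁ := ({e₀}ᶜ : Set E)) (F₂ := ({e₀} : Set E))
    disjoint_compl_left hA (dependsOn_openEdge e₀), prob_openEdge]

end Indep


section SetAlgebra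

variable {X : Type*}

/-- Set algebra: `Lb ∩ (O ∩ A) = (Lb ∩ A) ∩ O`. -/
lemma set_d1 (Lb O A : Set X) : Lb ∩ (O ∩ A) = (Lb ∩ A) ∩ O := by
  ext ω; simp only [Set.mem_inter_iff]; tauto

/-- Set algebra: `O ∩ (O ∩ A)ᶜ = Aᶜ ∩ O`. -/
lemma set_d2 (O A : Set X) : O ∩ (O ∩ A)ᶜ = Aᶜ ∩ O := by
  ext ω; simp only [Set.mem_inter_iff, Set.mem_compl_iff]; tauto

/-- Set algebra: `Lb ∩ O ∩ (O ∩ A)ᶜ = (Lb ∩ Aᶜ) ∩ O`. -/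
lemma set_d3 (Lb O A : Set X) : Lb ∩ O ∩ (O ∩ A)ᶜ = (Lb ∩ Aᶜ) ∩ O := by
  ext ω; simp only [Set.mem_inter_iff, Set.mem_compl_iff]; tauto

/-- Set algebra: `O ∩ Xo ∩ (O ∩ A)ᶜ = (Xo ∩ Aᶜ) ∩ O`. -/
lemma set_d4 (Xo O A : Set X) : O ∩ Xo ∩ (O ∩ A)ᶜ = (Xo ∩ Aᶜ) ∩ O := by
  ext ω; simp only [Set.mem_inter_iff, Set.mem_compl_iff]; tauto

/-- Set algebra: `Lb ∩ (O ∩ Xo) ∩ (O ∩ A)ᶜ = (Lb ∩ Xo ∩ Aᶜ) ∩ O`. -/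
lemma set_d5 (Lb Xo O A : Set X) : Lb ∩ (O ∩ Xo) ∩ (O ∩ A)ᶜ = (Lb ∩ Xo ∩ Aᶜ) ∩ O := by
  ext ω; simp only [Set.mem_inter_iff, Set.mem_compl_iff]; tauto

/-- Set algebra: `(Lo ∪ O ∩ Xo) ∩ (O ∩ A)ᶜ = (Lo ∩ (O ∩ A)ᶜ) ∪ ((Xo ∩ Aᶜ) ∩ O)`. -/
lemma set_d6 (Lo Xo O A : Set X) :
    (Lo ∪ O ∩ Xo) ∩ (O ∩ A)ᶜ = (Lo ∩ (O ∩ A)ᶜ) ∪ ((Xo ∩ Aᶜ) ∩ O) := by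
  ext ω; simp only [Set.mem_inter_iff, Set.mem_compl_iff, Set.mem_union]; tauto

/-- Set algebra: `O ∩ (Lo ∪ O ∩ Xo) ∩ (O ∩ A)ᶜ = ((Lo ∪ Xo) ∩ Aᶜ) ∩ O`. -/
lemma set_d7 (Lo Xo O A : Set X) : O ∩ (Lo ∪ O ∩ Xo) ∩ (O ∩ A)ᶜ = ((Lo ∪ Xo) ∩ Aᶜ) ∩ O := by
  ext ω; simp only [Set.mem_inter_iff, Set.mem_compl_iff, Set.mem_union]; tauto

/-- Set algebra: `Lb ∩ O ∩ (Lo ∪ O ∩ Xo) ∩ (O ∩ A)ᶜ = (Lb ∩ (Lo ∪ Xo) ∩ Aᶜ) ∩ O`. -/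
lemma set_d8 (Lb Lo Xo O A : Set X) :
    Lb ∩ O ∩ (Lo ∪ O ∩ Xo) ∩ (O ∩ A)ᶜ = (Lb ∩ (Lo ∪ Xo) ∩ Aᶜ) ∩ O := by
  ext ω; simp only [Set.mem_inter_iff, Set.mem_compl_iff, Set.mem_union]; tauto

/-- Set algebra: `(Lo ∪ Xo) ∩ Aᶜ = (Lo ∩ Aᶜ) ∪ (Xo ∩ Aᶜ)`. -/
lemma set_union_inter (Lo Xo A : Set X) : (Lo ∪ Xo) ∩ Aᶜ = (Lo ∩ Aᶜ) ∪ (Xo ∩ Aᶜ) := by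
  ext ω; simp only [Set.mem_inter_iff, Set.mem_compl_iff, Set.mem_union]; tauto

/-- Set algebra: `Lb ∩ (Lo ∪ Xo) ∩ Aᶜ = (Lb ∩ Lo ∩ Aᶜ) ∪ (Lb ∩ Xo ∩ Aᶜ)`. -/
lemma set_union_inter' (Lb Lo Xo A : Set X) :
    Lb ∩ (Lo ∪ Xo) ∩ Aᶜ = (Lb ∩ Lo ∩ Aᶜ) ∪ (Lb ∩ Xo ∩ Aᶜ) := by
  ext ω; simp only [Set.mem_inter_iff, Set.mem_compl_iff, Set.mem_union]; tauto

end SetAlgebra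

section Main

variable {V : Type*} {E : Type*} [Fintype E] [DecidableEq E] [Fintype V] [DecidableEq V]
  {R : Type*} [CommRing R] [LinearOrder R] [IsStrictOrderedRing R]

omit [Fintype E] [DecidableEq E] in
/-- Events determined by `{e₀}ᶜ` are closed under `∩`. -/
lemma dep_inter {e₀ : E} {A B : Set (Config E)} (hA : DependsOn (· ∈ A) ({e₀}ᶜ : Set E))
    (hB : DependsOn (· ∈ B) ({e₀}ᶜ : Set E)) : DependsOn (· ∈ A ∩ B) ({e₀}ᶜ : Set E) := by
  simpa using dependsOn_inter hA hB

omit [Fintype E] [DecidableEq E] in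
/-- Events determined by `{e₀}ᶜ` are closed under `∪`. -/
lemma dep_union {e₀ : E} {A B : Set (Config E)} (hA : DependsOn (· ∈ A) ({e₀}ᶜ : Set E))
    (hB : DependsOn (· ∈ B) ({e₀}ᶜ : Set E)) : DependsOn (· ∈ A ∪ B) ({e₀}ᶜ : Set E) := by
  simpa using dependsOn_union hA hB

/-- **The L-half of the weighted (PM) is nonnegative when `a₂` is a leaf at the host `u`**
(proofs/MINE2-CUTU.md Theorem 3): with `Q = {a₁ ↮ a₂}`, `L_b = {a₁ ↔ b}`, `H_u = {a₂ ↔ u}`,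
`H_o = {a₂ ↔ o}`, `oU = {a₁ ↔ o} ∪ {a₂ ↔ o}`,
`0 ≤ P(Q)·[P(Q) P(L_b H_u oU Q) − P(L_b Q) P(H_u oU Q)] − P(oU Q)·[P(Q) P(L_b H_u Q) − P(L_b Q) P(H_u Q)]
      − P(Q)·[P(Q) P(L_b H_o Q) − P(L_b Q) P(H_o Q)]`. -/
theorem halfL_nonneg (p : E → R) (hp : IsProbVec p) (ends : E → Sym2 V) (o a₁ a₂ b u : V)
    (e₀ : E) (hl : CaseOne.IsLeafAt ends u a₂ e₀) (h1 : a₁ ≠ a₂) (ho : o ≠ a₂) (hb : b ≠ a₂) :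
    0 ≤ prob p (connEvent ends a₁ a₂)ᶜ *
          (prob p (connEvent ends a₁ a₂)ᶜ *
              prob p (connEvent ends a₁ b ∩ connEvent ends a₂ u ∩
                (connEvent ends a₁ o ∪ connEvent ends a₂ o) ∩ (connEvent ends a₁ a₂)ᶜ) -
            prob p (connEvent ends a₁ b ∩ (connEvent ends a₁ a₂)ᶜ) *
              prob p (connEvent ends a₂ u ∩ (connEvent ends a₁ o ∪ connEvent ends a₂ o) ∩
                (connEvent ends a₁ a₂)ᶜ)) -
        prob p ((connEvent ends a₁ o ∪ connEvent ends a₂ o) ∩ (connEvent ends a₁ a₂)ᶜ) *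
          (prob p (connEvent ends a₁ a₂)ᶜ *
              prob p (connEvent ends a₁ b ∩ connEvent ends a₂ u ∩ (connEvent ends a₁ a₂)ᶜ) -
            prob p (connEvent ends a₁ b ∩ (connEvent ends a₁ a₂)ᶜ) *
              prob p (connEvent ends a₂ u ∩ (connEvent ends a₁ a₂)ᶜ)) -
        prob p (connEvent ends a₁ a₂)ᶜ *
          (prob p (connEvent ends a₁ a₂)ᶜ *
              prob p (connEvent ends a₁ b ∩ connEvent ends a₂ o ∩ (connEvent ends a₁ a₂)ᶜ) -
            prob p (connEvent ends a₁ b ∩ (connEvent ends a₁ a₂)ᶜ) *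
              prob p (connEvent ends a₂ o ∩ (connEvent ends a₁ a₂)ᶜ)) := by
  have hu : u ≠ a₂ := hl.ne
  -- the leaf dictionary for the events
  have hQ : connEvent ends a₁ a₂ = openEdge e₀ ∩ connEvent ends a₁ u := connEvent_leaf hl h1
  have hHu : connEvent ends a₂ u = openEdge e₀ := connEvent_leaf_u hl
  have hHo : connEvent ends a₂ o = openEdge e₀ ∩ connEvent ends o u := connEvent_leaf' hl ho
  rw [hQ, hHu, hHo]
  -- names
  set A := connEvent ends a₁ u with hA
  set O := openEdge e₀ with hO
  set Lb := connEvent ends a₁ b with hLb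
  set Lo := connEvent ends a₁ o with hLo
  set Xo := connEvent ends o u with hXo
  -- e₀-ignoring events
  have dA : DependsOn (· ∈ A) ({e₀}ᶜ : Set E) := dependsOn_connEvent_of_leaf hl h1 hu
  have dLb : DependsOn (· ∈ Lb) ({e₀}ᶜ : Set E) := dependsOn_connEvent_of_leaf hl h1 hb
  have dLo : DependsOn (· ∈ Lo) ({e₀}ᶜ : Set E) := dependsOn_connEvent_of_leaf hl h1 ho
  have dXo : DependsOn (· ∈ Xo) ({e₀}ᶜ : Set E) := dependsOn_connEvent_of_leaf hl ho hu
  have dAc : DependsOn (· ∈ Aᶜ) ({e₀}ᶜ : Set E) := dependsOn_compl dA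
  -- `a₁ ↔ o` and `o ↔ u` force `a₁ ↔ u`
  have hLoXo : Lo ∩ Xo ⊆ A := fun ω hω => conn_trans hω.1 hω.2
  have hdisj1 : Disjoint (Lo ∩ (O ∩ A)ᶜ) ((Xo ∩ Aᶜ) ∩ O) := by
    rw [Set.disjoint_left]
    rintro ω ⟨hLo', hc⟩ ⟨⟨hXo', hA'⟩, hO'⟩
    exact hA' (hLoXo ⟨hLo', hXo'⟩)
  have hdisj2 : Disjoint (Lo ∩ Aᶜ) (Xo ∩ Aᶜ) := by
    rw [Set.disjoint_left]
    rintro ω ⟨hLo', hA'⟩ ⟨hXo', _⟩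
    exact hA' (hLoXo ⟨hLo', hXo'⟩)
  have hdisj3 : Disjoint (Lb ∩ Lo ∩ Aᶜ) (Lb ∩ Xo ∩ Aᶜ) := by
    rw [Set.disjoint_left]
    rintro ω ⟨⟨_, hLo'⟩, hA'⟩ ⟨⟨_, hXo'⟩, _⟩
    exact hA' (hLoXo ⟨hLo', hXo'⟩)
  -- the masses
  have hβ0 : 0 ≤ p e₀ := hp.nonneg e₀
  have hβ1 : p e₀ ≤ 1 := hp.le_one e₀
  have htu1 : prob p A ≤ 1 := prob_le_one hp A
  have hAc : prob p Aᶜ = 1 - prob p A := prob_compl p A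
  have hsplit_b : prob p (Lb ∩ A) + prob p (Lb ∩ Aᶜ) = prob p Lb :=
    prob_inter_add_prob_inter_compl p Lb A
  have hsplit_o : prob p (Lo ∩ A) + prob p (Lo ∩ Aᶜ) = prob p Lo :=
    prob_inter_add_prob_inter_compl p Lo A
  -- dictionary
  have d0 : prob p (O ∩ A)ᶜ = 1 - prob p A * p e₀ := by
    rw [prob_compl, Set.inter_comm, prob_inter_openEdge_of_dependsOn p dA]
  have d1 : prob p (Lb ∩ (O ∩ A)ᶜ) = prob p Lb - prob p (Lb ∩ A) * p e₀ := by
    have := prob_inter_add_prob_inter_compl p Lb (O ∩ A)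
    rw [set_d1, prob_inter_openEdge_of_dependsOn p (dep_inter dLb dA)] at this
    linarith
  have d1o : prob p (Lo ∩ (O ∩ A)ᶜ) = prob p Lo - prob p (Lo ∩ A) * p e₀ := by
    have := prob_inter_add_prob_inter_compl p Lo (O ∩ A)
    rw [set_d1, prob_inter_openEdge_of_dependsOn p (dep_inter dLo dA)] at this
    linarith
  have d2 : prob p (O ∩ (O ∩ A)ᶜ) = (1 - prob p A) * p e₀ := by
    rw [set_d2, prob_inter_openEdge_of_dependsOn p dAc, hAc]
  have d3 : prob p (Lb ∩ O ∩ (O ∩ A)ᶜ) = prob p (Lb ∩ Aᶜ) * p e₀ := by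
    rw [set_d3, prob_inter_openEdge_of_dependsOn p (dep_inter dLb dAc)]
  have d4 : prob p (O ∩ Xo ∩ (O ∩ A)ᶜ) = prob p (Xo ∩ Aᶜ) * p e₀ := by
    rw [set_d4, prob_inter_openEdge_of_dependsOn p (dep_inter dXo dAc)]
  have d5 : prob p (Lb ∩ (O ∩ Xo) ∩ (O ∩ A)ᶜ) = prob p (Lb ∩ Xo ∩ Aᶜ) * p e₀ := by
    rw [set_d5, prob_inter_openEdge_of_dependsOn p (dep_inter (dep_inter dLb dXo) dAc)]
  have d6 : prob p ((Lo ∪ O ∩ Xo) ∩ (O ∩ A)ᶜ) =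
      (prob p Lo - prob p (Lo ∩ A) * p e₀) + prob p (Xo ∩ Aᶜ) * p e₀ := by
    rw [set_d6, prob_union_of_disjoint p hdisj1, d1o,
      prob_inter_openEdge_of_dependsOn p (dep_inter dXo dAc)]
  have d7 : prob p (O ∩ (Lo ∪ O ∩ Xo) ∩ (O ∩ A)ᶜ) =
      (prob p (Lo ∩ Aᶜ) + prob p (Xo ∩ Aᶜ)) * p e₀ := by
    rw [set_d7, prob_inter_openEdge_of_dependsOn p (dep_inter (dep_union dLo dXo) dAc),
      set_union_inter, prob_union_of_disjoint p hdisj2]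
  have d8 : prob p (Lb ∩ O ∩ (Lo ∪ O ∩ Xo) ∩ (O ∩ A)ᶜ) =
      (prob p (Lb ∩ Lo ∩ Aᶜ) + prob p (Lb ∩ Xo ∩ Aᶜ)) * p e₀ := by
    rw [set_d8, prob_inter_openEdge_of_dependsOn p
      (dep_inter (dep_inter dLb (dep_union dLo dXo)) dAc),
      set_union_inter', prob_union_of_disjoint p hdisj3]
  rw [d0, d1, d2, d3, d4, d5, d6, d7, d8]
  clear d0 d1 d1o d2 d3 d4 d5 d6 d7 d8 hdisj1 hdisj2 hdisj3
  -- the three correlation inequalities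
  have hBHK := bhk_same_cluster_events p hp ends a₁ u (𝓤 := {W : Set V | b ∈ W})
    (𝓥 := {W : Set V | o ∈ W}) (fun _ _ h hW => h hW) (fun _ _ h hW => h hW)
  rw [RProduct.clusterInEvent_mem_eq, RProduct.clusterInEvent_mem_eq] at hBHK
  have hHarris_b := prob_mul_prob_le_prob_inter hp (isUpperSet_connEvent ends a₁ b)
    (isUpperSet_connEvent ends a₁ u)
  have hHarris_o := prob_mul_prob_le_prob_inter hp (isUpperSet_connEvent ends a₁ o)
    (isUpperSet_connEvent ends a₁ u)
  -- nonnegativity and bounds of the masses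
  have hxo := prob_nonneg hp (Xo ∩ Aᶜ)
  have hmb := prob_nonneg hp (Lb ∩ Aᶜ)
  have hmo := prob_nonneg hp (Lo ∩ Aᶜ)
  have hmbo := prob_nonneg hp (Lb ∩ Lo ∩ Aᶜ)
  have hybo := prob_nonneg hp (Lb ∩ Xo ∩ Aᶜ)
  have hkbu := prob_nonneg hp (Lb ∩ A)
  have hkou := prob_nonneg hp (Lo ∩ A)
  have htu0 := prob_nonneg hp A
  have hmb_le : prob p (Lb ∩ Aᶜ) ≤ prob p Aᶜ := prob_mono hp Set.inter_subset_right
  have hmo_le : prob p (Lo ∩ Aᶜ) ≤ prob p Aᶜ := prob_mono hp Set.inter_subset_right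
  have hmbo_le : prob p (Lb ∩ Lo ∩ Aᶜ) ≤ prob p Aᶜ := prob_mono hp Set.inter_subset_right
  have hxo_le : prob p (Xo ∩ Aᶜ) ≤ prob p Aᶜ := prob_mono hp Set.inter_subset_right
  have hybo_le : prob p (Lb ∩ Xo ∩ Aᶜ) ≤ prob p Aᶜ := prob_mono hp Set.inter_subset_right
  rw [← hsplit_b, ← hsplit_o]
  rw [← hsplit_b] at hHarris_b
  rw [← hsplit_o] at hHarris_o
  clear hsplit_b hsplit_o dA dLb dLo dXo dAc hLoXo
  generalize hβ : p e₀ = β at *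
  generalize htu : prob p A = tu at *
  generalize hac : prob p Aᶜ = ac at *
  generalize hkbu' : prob p (Lb ∩ A) = kbu at *
  generalize hmb' : prob p (Lb ∩ Aᶜ) = mb at *
  generalize hkou' : prob p (Lo ∩ A) = kou at *
  generalize hmo' : prob p (Lo ∩ Aᶜ) = mo at *
  generalize hmbo' : prob p (Lb ∩ Lo ∩ Aᶜ) = mbo at *
  generalize hxo' : prob p (Xo ∩ Aᶜ) = xo at *
  generalize hybo' : prob p (Lb ∩ Xo ∩ Aᶜ) = ybo at *
  clear hβ htu hac hkbu' hmb' hkou' hmo' hmbo' hxo' hybo' hQ hHu hHo hl h1 ho hb hu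
  subst hAc
  have hCu : 0 ≤ mbo * (1 - tu) - mb * mo := by linarith only [hBHK]
  have hCb : 0 ≤ kbu - tu * (kbu + mb) := by linarith only [hHarris_b]
  have hCo : 0 ≤ kou - tu * (kou + mo) := by linarith only [hHarris_o]
  -- the key identity
  have key : (1 - tu) *
      ((1 - tu * β) * ((1 - tu * β) * ((mbo + ybo) * β) - (kbu + mb - kbu * β) * ((mo + xo) * β)) -
        (kou + mo - kou * β + xo * β) *
          ((1 - tu * β) * (mb * β) - (kbu + mb - kbu * β) * ((1 - tu) * β)) -
        (1 - tu * β) * ((1 - tu * β) * (ybo * β) - (kbu + mb - kbu * β) * (xo * β))) =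
      β * ((1 - tu * β) * (1 - tu * β) * (mbo * (1 - tu) - mb * mo) +
        (1 - β) * (kbu - tu * (kbu + mb)) *
          ((1 - β) * (kou - tu * (kou + mo)) + β * (1 - tu) * xo)) := by
    ring
  have h1β : 0 ≤ 1 - β := by linarith only [hβ1]
  have h1tu : 0 ≤ 1 - tu := by linarith only [htu1]
  have hRHS : 0 ≤ β * ((1 - tu * β) * (1 - tu * β) * (mbo * (1 - tu) - mb * mo) +
        (1 - β) * (kbu - tu * (kbu + mb)) *
          ((1 - β) * (kou - tu * (kou + mo)) + β * (1 - tu) * xo)) := by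
    apply mul_nonneg hβ0
    apply add_nonneg
    · exact mul_nonneg (mul_self_nonneg _) hCu
    · apply mul_nonneg (mul_nonneg h1β hCb)
      apply add_nonneg (mul_nonneg h1β hCo)
      exact mul_nonneg (mul_nonneg hβ0 h1tu) hxo
  rcases eq_or_lt_of_le h1tu with h | h
  · -- `t_u = 1`: every mass on `Aᶜ` vanishes
    have z1 : mb = 0 := le_antisymm (by linarith only [hmb_le, h]) hmb
    have z2 : mo = 0 := le_antisymm (by linarith only [hmo_le, h]) hmo
    have z3 : mbo = 0 := le_antisymm (by linarith only [hmbo_le, h]) hmbo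
    have z4 : xo = 0 := le_antisymm (by linarith only [hxo_le, h]) hxo
    have z5 : ybo = 0 := le_antisymm (by linarith only [hybo_le, h]) hybo
    have htu' : tu = 1 := by linarith only [h]
    rw [z1, z2, z3, z4, z5, htu']
    ring_nf
    exact le_refl _
  · exact (mul_nonneg_iff_of_pos_left h).mp (key ▸ hRHS)

end Main

end LeafRootPM

end Summit.Ventures.PercRepro2
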